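import Literature.IUT.HodgeTheaters.PMBaseXiGroupCompatExactSideCondition
import Literature.IUT.HodgeTheaters.PMBaseIsoTorsorExactSideConditionHT

/-!
# A sign-tagged model of `PMBaseKit`: the synchronisation law (α) does NOT imply [IUTchI] Prop 6.6 (ii), (iii), 6.8 (i)

S. Mochizuki, *Inter-universal Teichmüller theory I: construction of Hodge theaters*, §6, Definition 6.1
(ii)–(vii) pp. 156–159, Example 6.3 (i), (ii) pp. 160–161, Propositions 6.5 (i), 6.6 (ii), (iii), 6.8 (i)
pp. 163–168 of the kurims manuscript (May 2020) [claim: Mochizuki2012, status: disputed].  Model file (abc-iut cell,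
block F fact-proving wave, seat abc-iut-f-071 gen 4), companion of abc-iut-L5-t4's `PMBaseKitModel.lean` and of
`PMBaseXiGroupCompatExactSideCondition.lean`.

`PMBaseIsoTorsorExactSideCondition*.lean` / `PMBaseXiGroupCompatExactSideCondition.lean` proved, over an abstract
base kit `K : PMBaseKit l`:  (β) = `Ex63.NegCompatModel` ⟺ twisted `[−1]`-compatibility ∧ (α);  Prop 6.6 (ii) ⟺
6.6 (iii) ⟺ 6.8 (i) (all pairs / all theaters) ⟺ twisted `[−1]`-compatibility ⟹ relative synchronisation ⟺
Prop 6.5 (i), second sentence (all bridges) ⟸ (α) = `Ex63.PhiEllSync`; and separated twisted from (α).  The one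
separation left open there is settled here: a kit where (α) HOLDS while the twisted `[−1]`-compatibility FAILS.

THE MODEL (`PMBaseKit.tagKit l hl`, every prime `l ≠ 2`, one valuation): abc-iut-L5-t4's toy collage kit with ONE
change — a morphism `𝒟_v → 𝒟^{⊚±}` carries, besides "what it does on cusps" (an element of `AGL₁(𝔽_l)`), a SIGN TAG
in `{±1}` that records the parity of the automorphisms of `𝒟_v` it has been pre-composed with: `Hom(loc, glob) =
AGL₁(𝔽_l) × {±1}`, pre-composition by `ε ∈ Aut(loc) = {±1}` multiplies the tag by `ε`, post-composition by
`Aut(glob) = AGL₁(𝔽_l)` leaves it alone.  All interface clauses of Def 6.1 hold verbatim (labels are read off the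
`AGL₁` component), `φ^{Θell}_{•,v} := (1, +1)`, so (α) holds as for the toy kit (`Ex63.phiEllSync_tagKit`); but
`a ≫ φ^{Θell}_{•,v}` has tag `−1` for the negative automorphism `a = −1` while every `φ^{Theta ell}_{•,v} ≫ b` has tag `+1`:
NO negative automorphism of `𝒟_v` is intertwined by `φ^{Θell}_{•,v}` with anything (`tagKit_not_twistedNegCompat`).

CONSEQUENCES (`exists_kit_phiEllSync_not_forall_isoTorsor`): over `tagKit` (α) and Prop 6.5 (i) (all bridges) HOLD
while Prop 6.6 (ii) (some pair of `𝒟-Θ^{ell}`-bridges), 6.6 (iii), 6.8 (i), (β) and Ex 6.3 (ii) at `(0, −1)` FAIL —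
so (α) ⇏ (β), (α) ⇏ Prop 6.6 (ii), and relative synchronisation ⇏ twisted `[−1]`-compatibility; together with
the translated toy kit (twisted ∧ ¬(α)) the two kit-level inputs (α) and «twisted» are INDEPENDENT, and (β) is
exactly their conjunction.

No side taken on [IUTchIII] Cor. 3.12; nothing asserted about the genuine objects of [IUTchI] (where Example 6.3
(ii) supplies (β)); typed ≠ proved; a model is a consistency / independence witness for OUR interface only.
-/

namespace Literature.IUT.HodgeTheaters

open CategoryTheory

namespace PMBaseKit

namespace TagModel

variable (l : ℕ)

/-- (model plumbing) the affine action of `AGL₁(𝔽_l)` on `𝔽_l`, unfolded. [folklore] -/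
private theorem agl_smul_def (g : Model.AGL l) (z : ZMod l) :
    g • z = (g.right : ZMod l) * z + g.left.toAdd := rfl

/-- (model plumbing) the sign `ε ∈ {±1} ⊆ AGL₁(𝔽_l)` acts on `𝔽_l` by `z ↦ ε • z`. [folklore] -/
private theorem aglPerm_signToAGL (ε : ℤˣ) : Model.aglPerm l (Model.signToAGL l ε) = signPerm l ε := by
  ext z
  change (Model.signToAGL l ε) • z = ε • z
  simp [Model.signToAGL, agl_smul_def, Units.smul_def, zsmul_eq_mul]

/-- Objects of the sign-tagged collage category at a place: `loc` (the model `𝒟_v`) and `glob` (the model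
`𝒟^{⊚±}` seen at `v`). (model plumbing for [IUTchI] Def 6.1 p. 156) [claim: Mochizuki2012, status: disputed] -/
inductive Obj (l : ℕ) : Type
  /-- the local object -/
  | loc
  /-- the global object seen at the place -/
  | glob

/-- Morphisms of the sign-tagged collage category: as in abc-iut-L5-t4's collage category, except that a
morphism `loc → glob` carries a sign tag in `{±1}` next to its action on cusps.
(model plumbing for [IUTchI] Def 6.1 p. 156) [claim: Mochizuki2012, status: disputed] -/
@[reducible] def Hom : Obj l → Obj l → Type
  | .loc, .loc => ℤˣ
  | .loc, .glob => Model.AGL l × ℤˣ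
  | .glob, .glob => Model.AGL l
  | .glob, .loc => PEmpty

/-- Composition: on cusps as in the collage category; the tag is multiplied by the automorphisms of `loc` and
untouched by those of `glob`. (model plumbing for [IUTchI] Def 6.1 p. 156) [claim: Mochizuki2012, status: disputed] -/
@[reducible] def comp : ∀ {X Y Z : Obj l}, Hom l X Y → Hom l Y Z → Hom l X Z
  | .loc, .loc, .loc, f, g => g * f
  | .loc, .loc, .glob, f, g => (g.1 * Model.signToAGL l f, g.2 * f)
  | .loc, .glob, .glob, f, g => (g * f.1, f.2)
  | .glob, .glob, .glob, f, g => g * f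
  | .glob, .loc, _, f, _ => f.elim
  | .loc, .glob, .loc, _, g => g.elim
  | .glob, .glob, .loc, _, g => g.elim

/-- The sign-tagged collage category. (model plumbing for [IUTchI] Def 6.1 p. 156) [claim: Mochizuki2012, status: disputed] -/
instance : Category (Obj l) where
  Hom := Hom l
  id X := match X with
    | .loc => (1 : ℤˣ)
    | .glob => (1 : Model.AGL l)
  comp := comp l
  id_comp := by
    rintro (_ | _) (_ | _) f
    · exact mul_one f
    · change (f.1 * Model.signToAGL l 1, f.2 * 1) = f
      rw [map_one, mul_one, mul_one]
    · exact f.elim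
    · exact mul_one f
  comp_id := by
    rintro (_ | _) (_ | _) f
    · exact one_mul f
    · change (1 * f.1, f.2) = f
      rw [one_mul]
    · exact f.elim
    · exact one_mul f
  assoc := by
    rintro (_ | _) (_ | _) (_ | _) (_ | _) f g h <;>
      first
      | exact f.elim
      | exact g.elim
      | exact h.elim
      | simp only [comp, map_mul, mul_assoc]

/-- "What a morphism does on the `l` cusps" (the tag is forgotten). (model plumbing for [IUTchI] Def 6.1 p. 156)
[claim: Mochizuki2012, status: disputed] -/
def homPerm : ∀ {X Y : Obj l}, (X ⟶ Y) → Equiv.Perm (ZMod l)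
  | .loc, .loc, f => signPerm l f
  | .loc, .glob, f => Model.aglPerm l f.1
  | .glob, .glob, f => Model.aglPerm l f
  | .glob, .loc, f => f.elim

/-- (model plumbing) functoriality of `homPerm`. [folklore] -/
private theorem homPerm_comp {X Y Z : Obj l} (f : X ⟶ Y) (g : Y ⟶ Z) :
    homPerm l (f ≫ g) = (homPerm l f).trans (homPerm l g) := by
  rcases X with _ | _ <;> rcases Y with _ | _ <;> rcases Z with _ | _ <;>
    first
    | exact f.elim
    | exact g.elim
    | change homPerm l (comp l f g) = _
      ext z
      simp [homPerm, comp, agl_smul_def, ← aglPerm_signToAGL, Equiv.Perm.mul_def]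

/-- (model plumbing) `homPerm` of identities. [folklore] -/
private theorem homPerm_id (X : Obj l) : homPerm l (𝟙 X) = Equiv.refl _ := by
  rcases X with _ | _
  · change signPerm l 1 = _; ext z; simp
  · change Model.aglPerm l 1 = _; rw [map_one]; rfl

/-- There is no isomorphism `glob ≅ loc`. [folklore] -/
private theorem not_iso_glob_loc (φ : (Obj.glob : Obj l) ≅ Obj.loc) : False := (φ.hom : PEmpty).elim

/-- The functor `glob ↦` the global object seen at the place (tags untouched). (model plumbing for [IUTchI] Def 6.1
p. 156) [claim: Mochizuki2012, status: disputed] -/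
def atV' : SingleObj (Model.AGL l) ⥤ Obj l where
  obj _ := Obj.glob
  map f := f
  map_id _ := rfl
  map_comp _ _ := rfl

end TagModel

open TagModel

variable (l : ℕ)

/-- **The sign-tagged kit** `tagKit l` for every prime `l ≠ 2`: abc-iut-L5-t4's `toyKit` (same global side: `Glob`
the one-object category on `AGL₁(𝔽_l)`, `Aut ↠ 𝔽_l^⋇`, tautological torsor and fixed chart) with the sign-tagged
collage category at the single place and `φ^{Θell}_{•,v} := (1, +1)`; every clause of [IUTchI] Def 6.1 (ii)–(vii) as
packaged in `PMBaseKit` holds. ([IUTchI] Def 6.1 p.156) [claim: Mochizuki2012, status: disputed] -/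
noncomputable def tagKit [Fact l.Prime] (hl : l ≠ 2) : PMBaseKit.{0} l :=
  { PMBaseKit.toyKit l hl with
    V := Unit
    decEqV := inferInstanceAs (DecidableEq Unit)
    bad := ∅
    arc := ∅
    Amb := fun _ => Obj l
    catAmb := fun _ => inferInstance
    model := fun _ => Obj.loc
    pmObj := fun _ X => X
    toPM := fun _ X => 𝟙 X
    LabCuspPM := fun _ _ => ZMod l
    labPM := fun _ _ _ => FlPMGroup.tautological l
    labMap := fun _ {X Y} φ => homPerm l φ.hom
    labMap_refl := fun _ X => homPerm_id l X
    labMap_trans := fun _ {X Y Z} φ ψ => homPerm_comp l φ.hom ψ.hom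
    labMap_charts := by
      rintro _ (_ | _) (_ | _) hX hY φ e ⟨ε, rfl⟩
      · exact ⟨ε * φ.hom, by ext z; simp [homPerm, mul_smul]⟩
      · exact (not_iso_glob_loc l φ.symm).elim
      · exact (not_iso_glob_loc l φ).elim
      · exact (not_iso_glob_loc l hX.some).elim
    exists_negative := by
      rintro _ (_ | _) hX
      · refine ⟨⟨(-1 : ℤˣ), (-1 : ℤˣ), ?_, ?_⟩, fun h => ?_⟩
        · change (-1 : ℤˣ) * (-1) = 1
          simp
        · change (-1 : ℤˣ) * (-1) = 1
          simp
        have h1 := congrArg (fun σ => σ (1 : ZMod l)) h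
        simp only [homPerm, signPerm_apply, Units.smul_def, Units.val_neg, Units.val_one, neg_smul,
          one_smul, Equiv.refl_apply] at h1
        have h2 : ringChar (ZMod l) = 2 := neg_one_eq_one_iff.mp h1
        rw [ZMod.ringChar_zmod_n] at h2
        exact hl h2
      · exact (not_iso_glob_loc l hX.some).elim
    atV := fun _ => atV' l
    phiEll := fun _ => ((1 : Model.AGL l), (1 : ℤˣ))
    labOfHom := fun _ {X G} f => ⇑(homPerm l f)
    labOfHom_pre := fun _ {X Y G} φ f => by
      change ⇑(homPerm l (φ.hom ≫ f)) = _
      rw [homPerm_comp]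
      rfl
    labOfHom_post := fun _ {X G H} f ψ => by
      change ⇑(homPerm l (f ≫ (atV' l).map ψ.hom)) = _
      rw [homPerm_comp]
      rfl
    labOfHom_phiEll_bijective := fun _ => by
      change Function.Bijective (Model.aglPerm l 1)
      rw [map_one]
      exact (Equiv.refl _).bijective
    labOfHom_phiEll_charts := by
      rintro _ e ⟨ε, rfl⟩
      refine ⟨FlPM.mk 0 ε, ?_⟩
      ext z
      change (FlPM.mk (0 : ZMod l) ε) • z = ε • (Equiv.ofBijective _ _).symm z
      generalize hw : (Equiv.ofBijective _ _).symm z = w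
      rw [Equiv.symm_apply_eq] at hw
      change z = (1 : Model.AGL l) • w at hw
      rw [one_smul] at hw
      subst hw
      simp [FlPM.smul_def, FlPM.mk] }

/-- **(α) holds in the sign-tagged kit** ([IUTchI] Ex 6.3 (i) pp. 160–161): `φ^{Θell}_{•,v} = (1, +1)` acts as the
identity on cusps, so every local `±`-chart pulls back to `±` the fixed chart — as for the toy kit
(abc-iut-w4-d073's `Ex63.phiEllSync_toyKit`). [claim: Mochizuki2012, status: disputed] -/
theorem Ex63.phiEllSync_tagKit [Fact l.Prime] (hl : l ≠ 2) : Ex63.PhiEllSync (tagKit l hl) := by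
  classical
  rintro v e ⟨ε, rfl⟩
  refine ⟨ε, ?_⟩
  have hchart : ∀ z : ZMod l, (tagKit l hl).gChart₀ z = z := fun z => by
    change FlPM.toPerm l 1 z = z
    simp
  have hsymm : ∀ z : ZMod l,
      (Equiv.ofBijective _ ((tagKit l hl).labOfHom_phiEll_bijective v)).symm z = (z : ZMod l) := fun z => by
    rw [Equiv.symm_apply_eq]
    change z = (1 : Model.AGL l) • (z : ZMod l)
    rw [one_smul]
  refine Equiv.ext fun z => ?_
  change (signPerm l ε : Equiv.Perm (ZMod l))
      (((Equiv.ofBijective _ ((tagKit l hl).labOfHom_phiEll_bijective v)).symm z : ZMod l)) =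
    (signPerm l ε : Equiv.Perm (ZMod l)) (((tagKit l hl).gChart₀ z : ZMod l))
  rw [hsymm z, hchart z]

/-- **No negative automorphism of `𝒟_v` is intertwined by `φ^{Θell}_{•,v}` in the sign-tagged kit**: for every
automorphism `a` of `loc` and every `b ∈ Aut(glob)`, `a ≫ φ^{Θell}_{•,v} = φ^{Θell}_{•,v} ≫ b` forces the tag of `a` to be
`+1`, i.e. `a = 1`, which is not negative.  Hence the twisted `[−1]`-compatibility FAILS for every `d`
([IUTchI] Ex 6.3 (ii) p. 161 is genuine input, not carried by Def 6.1's interface even together with (α)).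
[claim: Mochizuki2012, status: disputed] -/
theorem tagKit_not_twistedNegCompat [Fact l.Prime] (hl : l ≠ 2) (d : ZMod l) :
    ¬ ∀ v, ∃ a : (tagKit l hl).model v ≅ (tagKit l hl).model v,
      (tagKit l hl).labMap v a = labNeg ((tagKit l hl).isLocal_model v) ∧
        ∃ b ∈ Ex63.lifts (tagKit l hl) (FlPM.mk d (-1)),
          a.hom ≫ (tagKit l hl).phiEll v = (tagKit l hl).phiEll v ≫ ((tagKit l hl).atV v).map b.hom := by
  intro h
  obtain ⟨a, ha, b, -, hab⟩ := h ()
  -- the tag of `a ≫ φ` is that of `a`, the tag of `φ ≫ b` is `+1`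
  have htag : (show ℤˣ from a.hom) = 1 := by
    have h2 := congrArg Prod.snd hab
    change (1 : ℤˣ) * (show ℤˣ from a.hom) = (1 : ℤˣ) at h2
    rwa [one_mul] at h2
  -- so `a` acts trivially on `±`-label classes, contradicting negativity
  have hpos : (tagKit l hl).labMap () a = Equiv.refl _ := by
    change signPerm l (show ℤˣ from a.hom) = Equiv.refl _
    rw [htag]
    ext z
    simp
  exact labNeg_ne_refl ((tagKit l hl).isLocal_model ()) (ha.symm.trans hpos)

/-- **The synchronisation law (α) does NOT imply Prop 6.6 (ii), (iii), 6.8 (i) or (β) over a kit** (explicit kit,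
universe `0`): over the sign-tagged kit `tagKit l hl` (`l` any odd prime) (α) = `Ex63.PhiEllSync` holds and so does
[IUTchI] Prop 6.5 (i), second sentence, for every `𝒟-Θ^{ell}`-bridge, while Prop 6.6 (ii) fails for some pair of
`𝒟-Θ^{ell}`-bridges, Prop 6.6 (iii) for some pair of `𝒟-Θ^{±ell}`-Hodge theaters, Prop 6.8 (i) for some theater, and
(β) = `Ex63.NegCompatModel` and the equivariance of Example 6.3 (ii) at `(0, −1)` fail.  With the translated toy kit
(`exists_kit_forall_isoTorsor_not_negCompatModel`: twisted ∧ ¬(α)) the kit-level inputs (α) and «twisted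
`[−1]`-compatibility» are INDEPENDENT, and relative synchronisation does not imply the twisted form.
[claim: Mochizuki2012, status: disputed] -/
theorem exists_kit_phiEllSync_not_forall_isoTorsor (l : ℕ) [Fact l.Prime] (hl : l ≠ 2) :
    ∃ K : PMBaseKit.{0} l, Nonempty K.V ∧ Ex63.PhiEllSync K ∧
      (∀ B : K.DThetaEllBridge, B.XiGroupCompat) ∧
      ¬ (∀ B₁ B₂ : K.DThetaEllBridge, DThetaEllBridge.IsoTorsor B₁ B₂) ∧
      ¬ (∀ H₁ H₂ : K.DThetaPMEllHT, DThetaPMEllHT.IsoTorsor H₁ H₂) ∧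
      ¬ (∀ H : K.DThetaPMEllHT, DThetaPMEllHT.EllBridgeSymmetry H) ∧
      ¬ Ex63.NegCompatModel K ∧ ¬ Ex63.Equivariant K (FlPM.mk 0 (-1)) := by
  haveI : NeZero l := ⟨(Fact.out : l.Prime).ne_zero⟩
  have hV : Nonempty (tagKit l hl).V := ⟨(show (tagKit l hl).V from ())⟩
  have hsync := Ex63.phiEllSync_tagKit l hl
  have hnt : ¬ (Nonempty (tagKit l hl).V → ∃ d : ZMod l, ∀ v,
      ∃ a : (tagKit l hl).model v ≅ (tagKit l hl).model v,
        (tagKit l hl).labMap v a = labNeg ((tagKit l hl).isLocal_model v) ∧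
          ∃ b ∈ Ex63.lifts (tagKit l hl) (FlPM.mk d (-1)),
            a.hom ≫ (tagKit l hl).phiEll v = (tagKit l hl).phiEll v ≫ ((tagKit l hl).atV v).map b.hom) := by
    intro h
    obtain ⟨d, hd⟩ := h hV
    exact tagKit_not_twistedNegCompat l hl d hd
  refine ⟨tagKit l hl, hV, hsync, fun B => DThetaEllBridge.xiGroupCompat_of_sync hsync B,
    fun h => hnt (DThetaEllBridge.forall_isoTorsor_iff_twistedNegCompat.mp h),
    fun h => hnt (DThetaPMEllHT.forall_isoTorsor_iff_twistedNegCompat.mp h),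
    fun h => hnt (DThetaPMEllHT.forall_ellBridgeSymmetry_iff_twistedNegCompat.mp h),
    fun h => tagKit_not_twistedNegCompat l hl 0 h,
    fun h => tagKit_not_twistedNegCompat l hl 0 (Ex63.negCompatModel_of_equivariant h)⟩

end PMBaseKit

end Literature.IUT.HodgeTheaters
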